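import Summits.HodgeConjecture.CorCM.TwoGroupCyclicSixteenTable
import Summits.HodgeConjecture.CorCM.GaloisThirtyTwoStructOfPowFour
import Summits.HodgeConjecture.CorCM.TwoGroupCyclicIndexTwoUniqueInvolution
import HarnessLib

/-!
# Degree `32` with an automorphism of order `16`: GOOD ⟹ structured (`D₃₂`, `SD₃₂`, `M₃₂` are BAD by table certificates)

COR-CM (cell `pub-hodgecm2`), binder seat b04 (gen 36), count-neutral own lane «Galois-CM-type classification».  KERNEL ONLY:
theorems; no definition, no named fact, no `sorry`.  `HC_CM` is neither used nor claimed.  ORDER-`32` BASE programme, PART II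
(fields whose Galois group has a NON-central involution; A7-JUNCTION gen-36 addendum): the cyclic-maximal-subgroup case, i.e. gen 35's
`struct_of_orderOf_eq_half` (`CorCM/GaloisTwoPowerCyclicNormalSquares`, `n ≥ 6`) brought down to `n = 5`.

**THEOREM (`struct_of_orderOf_sixteen`).**  `K` Galois CM of degree `32`, GOOD, `a ∈ Gal(K/ℚ)` of order `16`.  Then STRUCT
(`Gal ∈ {C₃₂, C₁₆ × C₂ (c ∈ C₁₆), Q₃₂}`).  Abelian: `struct_of_comm_thirtytwo`.  Otherwise `x ∉ ⟨a⟩` acts by one of `a ↦ a⁻¹, a⁷, a⁹`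
(gen 34's `conj_eq_or_of_orderOf_eq_two_pow`) and `c = a⁸`; `a ↦ a⁻¹` with `x² = a⁸` is `Q₃₂` (unique involution,
`struct_of_involution_unique`); `a ↦ a⁻¹` with `x² = 1` is `D₃₂`, `a ↦ a⁷` is `SD₃₂` (after `x ↦ xa` if `x² = a⁸`), `a ↦ a⁹` is `M₃₂`
(after `x ↦ x a^{3k}` if `x² = a^{2k}`) — each BAD by a `(T₀, D)` certificate (primitive CM set of rank `9 < 17`, balanced set of size `8`,
scratch-g36/es/a16cert.py, `decide`) on the table of `CorCM/TwoGroupCyclicSixteenTable`: census rows #48, #47, #33 of gen 23, which were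
skew rows without a written certificate.

## References

* [Shimura1998] G. Shimura, *Abelian Varieties with Complex Multiplication and Modular Functions*, §6.2 Thm. 3, §8.2 Prop. 26.
* [Gordon1999HodgeAVSurvey] B. B. Gordon, *A survey of the Hodge conjecture for abelian varieties*, Thm. 6.4, §9.3.
* [Rotman1995] J. J. Rotman, *An Introduction to the Theory of Groups*, 4th ed., GTM 148, Thm. 5.46 and Cor. 5.45.
-/

noncomputable section

open CategoryTheory CategoryTheory.Limits NumberField
open scoped BigOperators

namespace Summit.HodgeConjecture.CorCM.GaloisModels

open Literature.NumberTheory.ComplexMultiplication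
open Literature.AlgebraicGeometry.Motives (AbelianVariety CMType)
open Literature.AlgebraicGeometry.HodgeTheory
open Literature.AlgebraicGeometry.ComplexMultiplication (IsCMTypeRealisation)
open Literature.AlgebraicGeometry.Pohlmann1968
open Literature.Barriers.HodgeConjecture (divisorClassesSpan)
open Summit.HodgeConjecture.CorCM.GaloisRank
open Summit.HodgeConjecture.CorCM.GaloisModels.CyclicSixteen
open Summit.HodgeConjecture.CorCM.GaloisModels.UniqueInvolution (conj_eq_or_of_orderOf_eq_two_pow)

variable {K : Type} [Field K] [NumberField K] [IsCMField K] [IsGalois ℚ K]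

/-! ## §1 Certificates on the law-A table -/

/-- **Certificate format**: `[K:ℚ] = 32`, `r ∈ Gal(K/ℚ)` of order `16`, `s ∉ ⟨r⟩`, `s r = r^μ s`, `s² = r^τ`, complex conjugation `c = r⁸`;
the law of `CorCM/TwoGroupCyclicSixteenTable` with its unit and left-inverse identities; a CM set `T₀ ⊆ ℤ/16 × 𝔽₂` for `c₀ = (8,0)` with
trivial left stabiliser and a balanced `D` with `c₀D ≠ D` ⟹ a simple DEGENERATE CM abelian `16`-fold with an exceptional Hodge class
on a power. [cite: Shimura1998, §6.2 Thm. 3 and §8.2 Prop. 26] [cite: Gordon1999HodgeAVSurvey, Thm. 6.4 and §9.3] -/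
theorem exists_simple_degenerate_of_lawA_sixteen_table (hdeg : Module.finrank ℚ K = 32) (μ τ : ZMod 16) (r s : K ≃ₐ[ℚ] K)
    (hr : orderOf r = 16) (hs : s ∉ Subgroup.zpowers r) (hsr : s * r = r ^ μ.val * s) (hss : s * s = r ^ τ.val)
    (hc : (IsCMField.complexConj K).restrictScalars ℚ = r ^ 8)
    (mul : ZMod 16 × ZMod 2 → ZMod 16 × ZMod 2 → ZMod 16 × ZMod 2)
    (hm : ∀ p q : ZMod 16 × ZMod 2, mul p q =
      (p.1 + (if p.2 = 0 then q.1 else μ * q.1) + (if p.2 = 1 ∧ q.2 = 1 then τ else 0), p.2 + q.2))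
    (ho : ∀ p : ZMod 16 × ZMod 2, mul p (0, 0) = p)
    (hlinv : ∀ p q : ZMod 16 × ZMod 2, mul (if p.2 = 0 then (-p.1, 0) else (-(μ * (τ + p.1)), 1)) (mul p q) = q)
    (T₀ : Finset (ZMod 16 × ZMod 2)) (hcm : ∀ z : ZMod 16 × ZMod 2, z ∈ T₀ ↔ mul (8, 0) z ∉ T₀)
    (hprim : ∀ v : ZMod 16 × ZMod 2, v ≠ (0, 0) → ∃ w : ZMod 16 × ZMod 2, ¬ (w ∈ T₀ ↔ mul v w ∈ T₀))
    (D : Finset (ZMod 16 × ZMod 2)) (hbal : ∀ g : ZMod 16 × ZMod 2, 2 * (D.filter fun z => mul z g ∈ T₀).card = D.card)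
    (hmov : ∃ z ∈ D, mul (8, 0) z ∉ D) :
    ∃ (Φ : CMType K) (φ : K →+* ℂ) (X : AbelianVariety ℂ) (ι : 𝓞 K →+* End X)
      (ϑ : K →+* Module.End ℂ (complexBetti X.X 1)),
      IsPrimitive (ℂ ≃+* ℂ) Φ.1 φ ∧ ¬ IsNondegenerate Φ ∧ IsCMTypeRealisation Φ X ι ϑ ∧ X.IsSimple ∧ X.dim = 16 ∧
      ∃ m p : ℕ, ∃ z : complexBetti (⨁ fun _ : Fin m => X).X (2 * p), IsRationalClass z ∧
        IsOfHodgeType (⨁ fun _ : Fin m => X).dim (⨁ fun _ : Fin m => X).X (2 * p) p p z ∧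
        z ∉ divisorClassesSpan (⨁ fun _ : Fin m => X).X (⨁ fun _ : Fin m => X).dim p := by
  classical
  have hcard : Nat.card (K ≃ₐ[ℚ] K) = 32 := by
    rw [Nat.card_eq_fintype_card, card_model_eq_finrank (MulEquiv.refl (K ≃ₐ[ℚ] K)), hdeg]
  obtain ⟨e, he, hef⟩ := exists_table_lawA_sixteen hcard μ τ hr hs hsr hss mul hm ho hlinv
  have hec : e ((IsCMField.complexConj K).restrictScalars ℚ) = (8, 0) := by
    rw [hc, ← hef (8, 0)]
    simp only [show ((8 : ZMod 16)).val = 8 from rfl, show ((0 : ZMod 2)).val = 0 from rfl, pow_zero, mul_one]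
  have he1 : e 1 = (0, 0) := by
    rw [← hef (0, 0)]
    simp only [ZMod.val_zero, pow_zero, mul_one]
  have h := exists_simple_degenerate_of_table_balanced mul e he (8, 0) hec (0, 0) he1 T₀ hcm hprim D hbal hmov
  have h16 : Fintype.card (ZMod 16 × ZMod 2) / 2 = 16 := by simp [Fintype.card_prod, ZMod.card]
  rwa [h16] at h

set_option synthInstance.maxSize 4096 in
/-- **`s r = r¹⁵ s`, `s² = 1`** (`Gal(K/ℚ) ≅ D₃₂`, `c = r⁸`; census row #48): a simple DEGENERATE CM abelian `16`-fold (primitive CM set of rank `9 < 17`, balanced set of size `8`, by `decide`). [cite: Shimura1998, §6.2 Thm. 3 and §8.2 Prop. 26] [cite: Gordon1999HodgeAVSurvey, Thm. 6.4 and §9.3] -/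
theorem exists_simple_degenerate_lawA_dihedral_thirtytwo (hdeg : Module.finrank ℚ K = 32) (r s : K ≃ₐ[ℚ] K) (hr : orderOf r = 16) (hs : s ∉ Subgroup.zpowers r)
    (hsr : s * r = r ^ 15 * s) (hss : s * s = 1) (hc : (IsCMField.complexConj K).restrictScalars ℚ = r ^ 8) :
    ∃ (Φ : CMType K) (φ : K →+* ℂ) (X : AbelianVariety ℂ) (ι : 𝓞 K →+* End X)
      (ϑ : K →+* Module.End ℂ (complexBetti X.X 1)),
      IsPrimitive (ℂ ≃+* ℂ) Φ.1 φ ∧ ¬ IsNondegenerate Φ ∧ IsCMTypeRealisation Φ X ι ϑ ∧ X.IsSimple ∧ X.dim = 16 ∧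
      ∃ m p : ℕ, ∃ z : complexBetti (⨁ fun _ : Fin m => X).X (2 * p), IsRationalClass z ∧
        IsOfHodgeType (⨁ fun _ : Fin m => X).dim (⨁ fun _ : Fin m => X).X (2 * p) p p z ∧
        z ∉ divisorClassesSpan (⨁ fun _ : Fin m => X).X (⨁ fun _ : Fin m => X).dim p :=
  exists_simple_degenerate_of_lawA_sixteen_table hdeg 15 0 r s hr hs (by rw [show ((15 : ZMod 16)).val = 15 from rfl]; exact hsr) (by rw [show ((0 : ZMod 16)).val = 0 from rfl, pow_zero]; exact hss) hc
    (fun p q : ZMod 16 × ZMod 2 =>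
      (p.1 + (if p.2 = 0 then q.1 else 15 * q.1) + (if p.2 = 1 ∧ q.2 = 1 then 0 else 0), p.2 + q.2))
    (fun _ _ => rfl) (by decide) (by decide)
    {(0, 0), (1, 0), (1, 1), (2, 1), (4, 0), (4, 1), (6, 0), (6, 1), (7, 1), (8, 1), (10, 0), (11, 0), (11, 1),
    (13, 0), (13, 1), (15, 0)}
    (by decide) (by decide)
    {(0, 0), (0, 1), (1, 0), (4, 0), (9, 0), (9, 1), (12, 1), (13, 0)}
    (by decide) (by decide)

set_option synthInstance.maxSize 4096 in
/-- **`s r = r⁷ s`, `s² = 1`** (`Gal(K/ℚ) ≅ SD₃₂`, `c = r⁸`; census row #47): a simple DEGENERATE CM abelian `16`-fold (primitive CM set of rank `9 < 17`, balanced set of size `8`, by `decide`). [cite: Shimura1998, §6.2 Thm. 3 and §8.2 Prop. 26] [cite: Gordon1999HodgeAVSurvey, Thm. 6.4 and §9.3] -/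
theorem exists_simple_degenerate_lawA_semidihedral_thirtytwo (hdeg : Module.finrank ℚ K = 32) (r s : K ≃ₐ[ℚ] K) (hr : orderOf r = 16) (hs : s ∉ Subgroup.zpowers r)
    (hsr : s * r = r ^ 7 * s) (hss : s * s = 1) (hc : (IsCMField.complexConj K).restrictScalars ℚ = r ^ 8) :
    ∃ (Φ : CMType K) (φ : K →+* ℂ) (X : AbelianVariety ℂ) (ι : 𝓞 K →+* End X)
      (ϑ : K →+* Module.End ℂ (complexBetti X.X 1)),
      IsPrimitive (ℂ ≃+* ℂ) Φ.1 φ ∧ ¬ IsNondegenerate Φ ∧ IsCMTypeRealisation Φ X ι ϑ ∧ X.IsSimple ∧ X.dim = 16 ∧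
      ∃ m p : ℕ, ∃ z : complexBetti (⨁ fun _ : Fin m => X).X (2 * p), IsRationalClass z ∧
        IsOfHodgeType (⨁ fun _ : Fin m => X).dim (⨁ fun _ : Fin m => X).X (2 * p) p p z ∧
        z ∉ divisorClassesSpan (⨁ fun _ : Fin m => X).X (⨁ fun _ : Fin m => X).dim p :=
  exists_simple_degenerate_of_lawA_sixteen_table hdeg 7 0 r s hr hs (by rw [show ((7 : ZMod 16)).val = 7 from rfl]; exact hsr) (by rw [show ((0 : ZMod 16)).val = 0 from rfl, pow_zero]; exact hss) hc
    (fun p q : ZMod 16 × ZMod 2 =>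
      (p.1 + (if p.2 = 0 then q.1 else 7 * q.1) + (if p.2 = 1 ∧ q.2 = 1 then 0 else 0), p.2 + q.2))
    (fun _ _ => rfl) (by decide) (by decide)
    {(0, 1), (1, 0), (1, 1), (2, 1), (3, 1), (4, 1), (7, 0), (7, 1), (8, 0), (10, 0), (11, 0), (12, 0), (13, 0),
    (13, 1), (14, 0), (14, 1)}
    (by decide) (by decide)
    {(0, 0), (0, 1), (2, 0), (2, 1), (4, 0), (4, 1), (11, 0), (11, 1)}
    (by decide) (by decide)

set_option synthInstance.maxSize 4096 in
/-- **`s r = r⁹ s`, `s² = 1`** (`Gal(K/ℚ) ≅ M₃₂`, `c = r⁸`; census row #33): a simple DEGENERATE CM abelian `16`-fold (primitive CM set of rank `9 < 17`, balanced set of size `8`, by `decide`). [cite: Shimura1998, §6.2 Thm. 3 and §8.2 Prop. 26] [cite: Gordon1999HodgeAVSurvey, Thm. 6.4 and §9.3] -/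
theorem exists_simple_degenerate_lawA_modular_thirtytwo (hdeg : Module.finrank ℚ K = 32) (r s : K ≃ₐ[ℚ] K) (hr : orderOf r = 16) (hs : s ∉ Subgroup.zpowers r)
    (hsr : s * r = r ^ 9 * s) (hss : s * s = 1) (hc : (IsCMField.complexConj K).restrictScalars ℚ = r ^ 8) :
    ∃ (Φ : CMType K) (φ : K →+* ℂ) (X : AbelianVariety ℂ) (ι : 𝓞 K →+* End X)
      (ϑ : K →+* Module.End ℂ (complexBetti X.X 1)),
      IsPrimitive (ℂ ≃+* ℂ) Φ.1 φ ∧ ¬ IsNondegenerate Φ ∧ IsCMTypeRealisation Φ X ι ϑ ∧ X.IsSimple ∧ X.dim = 16 ∧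
      ∃ m p : ℕ, ∃ z : complexBetti (⨁ fun _ : Fin m => X).X (2 * p), IsRationalClass z ∧
        IsOfHodgeType (⨁ fun _ : Fin m => X).dim (⨁ fun _ : Fin m => X).X (2 * p) p p z ∧
        z ∉ divisorClassesSpan (⨁ fun _ : Fin m => X).X (⨁ fun _ : Fin m => X).dim p :=
  exists_simple_degenerate_of_lawA_sixteen_table hdeg 9 0 r s hr hs (by rw [show ((9 : ZMod 16)).val = 9 from rfl]; exact hsr) (by rw [show ((0 : ZMod 16)).val = 0 from rfl, pow_zero]; exact hss) hc
    (fun p q : ZMod 16 × ZMod 2 =>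
      (p.1 + (if p.2 = 0 then q.1 else 9 * q.1) + (if p.2 = 1 ∧ q.2 = 1 then 0 else 0), p.2 + q.2))
    (fun _ _ => rfl) (by decide) (by decide)
    {(0, 1), (1, 0), (2, 0), (3, 0), (4, 0), (5, 1), (6, 0), (7, 0), (8, 0), (9, 1), (10, 1), (11, 1), (12, 1),
    (13, 0), (14, 1), (15, 1)}
    (by decide) (by decide)
    {(0, 0), (0, 1), (2, 0), (2, 1), (4, 0), (4, 1), (13, 0), (13, 1)}
    (by decide) (by decide)

/-! ## §2 The theorem -/

/-- **GOOD Galois CM fields of degree `32` with an automorphism of order `16` are structured** (`Gal ∈ {C₃₂, C₁₆ × C₂ (c ∈ C₁₆), Q₃₂}`;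
`D₃₂`, `SD₃₂`, `M₃₂` and `C₁₆ × C₂` with `c ∉ C₁₆` are BAD). [cite: Rotman1995, Thm. 5.46 and Cor. 5.45]
[cite: Shimura1998, §6.2 Thm. 3 and §8.2 Prop. 26] [cite: Gordon1999HodgeAVSurvey, Thm. 6.4 and §9.3] -/
theorem struct_of_orderOf_sixteen (hdeg : Module.finrank ℚ K = 32)
    (hgood : ∀ (Φ : CMType K) (φ : K →+* ℂ), IsPrimitive (ℂ ≃+* ℂ) Φ.1 φ → IsNondegenerate Φ)
    (a : K ≃ₐ[ℚ] K) (ha : orderOf a = 16) :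
    ∃ (H E : Subgroup (K ≃ₐ[ℚ] K)) (k : ℕ), H.IsComplement' E ∧ (IsCMField.complexConj K).restrictScalars ℚ ∈ H ∧
      (IsCMField.complexConj K).restrictScalars ℚ ∉ E ∧ (∀ e ∈ E, e * e = 1 ∧ ∀ g : K ≃ₐ[ℚ] K, g * e = e * g) ∧
      Nat.card E ≤ 2 ∧ Nat.card H = 2 ^ k ∧ (IsCyclic H ∨ (3 ≤ k ∧ Nonempty (H ≃* QuaternionGroup (2 ^ (k - 2))))) := by
  classical
  set c := (IsCMField.complexConj K).restrictScalars ℚ with hcdef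
  have hcc : c * c = 1 := model_complexConj_mul_self (MulEquiv.refl (K ≃ₐ[ℚ] K)) (by simp [hcdef])
  have hc1 : c ≠ 1 := model_complexConj_ne_one (MulEquiv.refl (K ≃ₐ[ℚ] K)) (by simp [hcdef])
  have hccen : ∀ g : K ≃ₐ[ℚ] K, g * c = c * g := fun g =>
    (model_complexConj_comm (MulEquiv.refl (K ≃ₐ[ℚ] K)) (by simp [hcdef]) g).symm
  have hcard : Nat.card (K ≃ₐ[ℚ] K) = 32 := by
    rw [Nat.card_eq_fintype_card, card_model_eq_finrank (MulEquiv.refl (K ≃ₐ[ℚ] K)), hdeg]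
  have hdeg5 : Module.finrank ℚ K = 2 ^ 5 := by rw [hdeg]; norm_num
  by_cases hab : ∀ g h : K ≃ₐ[ℚ] K, g * h = h * g
  · exact struct_of_comm_thirtytwo hdeg hgood hab
  push Not at hab
  obtain ⟨g₀, h₀, hgh⟩ := hab
  have ha16 : a ^ 16 = 1 := by rw [← ha]; exact pow_orderOf_eq_one a
  have ha8 : a ^ 8 * a ^ 8 = 1 := by rw [← pow_add]; exact ha16
  have ha8ne : a ^ 8 ≠ 1 := fun h => by
    have := orderOf_dvd_of_pow_eq_one h; rw [ha] at this; omega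
  set A := Subgroup.zpowers a with hAdef
  have hAcard : Nat.card A = 16 := by rw [hAdef, Nat.card_zpowers, ha]
  have hAidx : A.index = 2 := by
    have h1 := A.card_mul_index
    rw [hAcard, hcard] at h1
    omega
  haveI hAn : A.Normal := Subgroup.normal_of_index_eq_two hAidx
  -- powers of `a` as natural exponents
  have hmemA : ∀ g : K ≃ₐ[ℚ] K, g ∈ A → ∃ n : ℕ, a ^ n = g := fun g hg => by
    rw [hAdef, ← mem_powers_iff_mem_zpowers] at hg
    exact (Submonoid.mem_powers_iff _ _).1 hg
  -- an element outside `A`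
  have hxA : ∃ x : K ≃ₐ[ℚ] K, x ∉ A := by
    by_contra h
    push Not at h
    apply hgh
    obtain ⟨i, hi⟩ := hmemA g₀ (h g₀)
    obtain ⟨j, hj⟩ := hmemA h₀ (h h₀)
    rw [← hi, ← hj, ← pow_add, ← pow_add, add_comm]
  obtain ⟨x, hx⟩ := hxA
  have hnf : ∀ g : K ≃ₐ[ℚ] K, (∃ i : ℕ, g = a ^ i) ∨ (∃ i : ℕ, g = x * a ^ i) := by
    intro g
    by_cases hg : g ∈ A
    · obtain ⟨i, hi⟩ := hmemA g hg; exact Or.inl ⟨i, hi.symm⟩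
    · have h1 : x⁻¹ * g ∈ A := by
        rw [Subgroup.mul_mem_iff_of_index_two hAidx]
        exact ⟨fun h => absurd (by simpa using h) hx, fun h => absurd h hg⟩
      obtain ⟨i, hi⟩ := hmemA _ h1
      exact Or.inr ⟨i, by rw [hi, mul_inv_cancel_left]⟩
  -- `x` does not commute with `a` (else `Gal(K/ℚ)` would be abelian)
  have hxa_ne : x * a * x⁻¹ ≠ a := by
    intro hθ
    have hxa : x * a = a * x := by rw [← inv_mul_cancel_right (x * a) x, hθ]
    have hca : ∀ g : K ≃ₐ[ℚ] K, g * a = a * g := by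
      intro g
      rcases hnf g with ⟨i, rfl⟩ | ⟨i, rfl⟩
      · exact ((Commute.refl a).pow_left i).eq
      · rw [mul_assoc, ((Commute.refl a).pow_left i).eq, ← mul_assoc, hxa, mul_assoc]
    have hcx : ∀ g : K ≃ₐ[ℚ] K, g * x = x * g := by
      intro g
      rcases hnf g with ⟨i, rfl⟩ | ⟨i, rfl⟩
      · exact ((show Commute a x from hxa.symm).pow_left i).eq
      · rw [mul_assoc, ((show Commute a x from hxa.symm).pow_left i).eq, ← mul_assoc]
    apply hgh
    rcases hnf h₀ with ⟨i, rfl⟩ | ⟨i, rfl⟩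
    · exact ((show Commute a g₀ from (hca g₀).symm).pow_left i).eq.symm
    · rw [← mul_assoc, hcx g₀, mul_assoc, ((show Commute a g₀ from (hca g₀).symm).pow_left i).eq.symm, ← mul_assoc]
  -- `c = a⁸`: an involution of `A`, because `c = x aⁱ` would make `x` commute with `a`
  have hcA : c = a ^ 8 := by
    rcases hnf c with ⟨i, hi⟩ | ⟨i, hi⟩
    · exact involution_eq_of_mem_zpowers (m := 4) (by rw [ha]; norm_num) (hi ▸ Subgroup.pow_mem _ (Subgroup.mem_zpowers a) i)
        hcc hc1 (Subgroup.pow_mem _ (Subgroup.mem_zpowers a) 8) ha8 ha8ne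
    · exfalso
      apply hxa_ne
      have h1 : x = c * (a ^ i)⁻¹ := by rw [hi, mul_inv_cancel_right]
      have h2 : (a ^ i)⁻¹ * a = a * (a ^ i)⁻¹ := (((Commute.refl a).pow_left i).inv_left).eq
      rw [h1]
      calc c * (a ^ i)⁻¹ * a * (c * (a ^ i)⁻¹)⁻¹ = c * ((a ^ i)⁻¹ * a) * ((a ^ i) * c⁻¹) := by group
        _ = c * (a * (a ^ i)⁻¹) * ((a ^ i) * c⁻¹) := by rw [h2]
        _ = c * a * c⁻¹ := by group
        _ = a := by rw [← hccen a]; group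
  have hcA' : (IsCMField.complexConj K).restrictScalars ℚ = a ^ 8 := by rw [← hcdef]; exact hcA
  -- the action of `x` on `a`: `x a x⁻¹ = aᵏ` with `a^{k²} = a`
  obtain ⟨k, hk⟩ := hmemA _ (hAn.conj_mem a (Subgroup.mem_zpowers a) x)
  obtain ⟨sN, hsN⟩ := hmemA _ (Subgroup.mul_self_mem_of_index_two hAidx x)
  have hkk : a ^ (k * k) = a := by
    rw [pow_mul, hk, conj_pow, hk, show x * (x * a * x⁻¹) * x⁻¹ = (x * x) * a * (x * x)⁻¹ by group, ← hsN,
      ((Commute.refl a).pow_left sN).eq, mul_inv_cancel_right]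
  have hfour := conj_eq_or_of_orderOf_eq_two_pow (m := 4) (by norm_num) ha hk.symm hkk
  simp only [show (4 : ℕ) - 1 = 3 by norm_num, show (2 : ℕ) ^ 3 = 8 by norm_num] at hfour
  -- `x x² x⁻¹ = x²`
  have hconjsq : x * a ^ sN * x⁻¹ = a ^ sN := by rw [hsN]; group
  rcases hfour with hθ | hθ | ⟨-, hθ | hθ⟩
  · exact absurd hθ hxa_ne
  · /- `x a x⁻¹ = a⁻¹`: `x² ∈ {1, a⁸}` -/
    have ha15 : a ^ 15 = a⁻¹ := by rw [eq_inv_iff_mul_eq_one, ← pow_succ, ha16]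
    have hsr : x * a = a ^ 15 * x := by rw [ha15, ← hθ, inv_mul_cancel_right]
    have hs2 : a ^ sN * a ^ sN = 1 := by
      have h1 := hconjsq
      rw [← conj_pow, hθ, inv_pow] at h1
      calc a ^ sN * a ^ sN = (a ^ sN)⁻¹ * a ^ sN := by rw [h1]
        _ = 1 := inv_mul_cancel _
    have hsN' : x * x = 1 ∨ x * x = a ^ 8 := by
      have hdvd := orderOf_dvd_of_pow_eq_one (show a ^ (sN + sN) = 1 by rw [pow_add]; exact hs2)
      rw [ha] at hdvd
      have h8 : 8 ∣ sN := by omega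
      obtain ⟨q, rfl⟩ := h8
      rcases Nat.even_or_odd q with ⟨m, rfl⟩ | ⟨m, rfl⟩
      · left; rw [← hsN, show 8 * (m + m) = 16 * m by ring, pow_mul, ha16, one_pow]
      · right; rw [← hsN, show 8 * (2 * m + 1) = 16 * m + 8 by ring, pow_add, pow_mul, ha16, one_pow, one_mul]
    rcases hsN' with hxx | hxx
    · -- `D₃₂`
      exfalso
      obtain ⟨Φ, φ, X, ι, ϑ, H1, H2, -⟩ :=
        exists_simple_degenerate_lawA_dihedral_thirtytwo hdeg a x ha hx hsr hxx hcA'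
      exact H2 (hgood Φ φ H1)
    · -- `Q₃₂`: the unique involution is `a⁸ = c`
      refine struct_of_involution_unique hdeg5 fun σ hσσ hσ1 => ?_
      rw [hcA']
      rcases hnf σ with ⟨i, rfl⟩ | ⟨i, rfl⟩
      · exact involution_eq_of_mem_zpowers (m := 4) (by rw [ha]; norm_num) (Subgroup.pow_mem _ (Subgroup.mem_zpowers a) i)
          hσσ hσ1 (Subgroup.pow_mem _ (Subgroup.mem_zpowers a) 8) ha8 ha8ne
      · exfalso
        -- `(x aⁱ)² = (x aⁱ x⁻¹) x² aⁱ = a⁻ⁱ a⁸ aⁱ = a⁸ ≠ 1`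
        have hc8 : (a ^ i)⁻¹ * a ^ 8 = a ^ 8 * (a ^ i)⁻¹ := (((Commute.refl a).pow_pow i 8).inv_left).eq
        have h1 : x * a ^ i * (x * a ^ i) = a ^ 8 := by
          calc x * a ^ i * (x * a ^ i) = (x * a ^ i * x⁻¹) * (x * x) * a ^ i := by group
            _ = (a ^ i)⁻¹ * a ^ 8 * a ^ i := by rw [← conj_pow, hθ, inv_pow, hxx]
            _ = a ^ 8 * ((a ^ i)⁻¹ * a ^ i) := by rw [hc8, mul_assoc]
            _ = a ^ 8 := by rw [inv_mul_cancel, mul_one]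
        rw [h1] at hσσ
        exact ha8ne hσσ
  · /- `x a x⁻¹ = a a⁸ = a⁹`: `M₃₂` -/
    exfalso
    have hθ' : x * a * x⁻¹ = a ^ 9 := by rw [hθ, ← pow_succ']
    have hxr : x * a = a ^ 9 * x := by rw [← hθ', inv_mul_cancel_right]
    -- `x² = a^{sN}` with `sN` even
    have hseven : Even sN := by
      have h1 := hconjsq
      rw [← conj_pow, hθ', ← pow_mul] at h1
      have h2 := pow_inj_mod.1 h1
      rw [ha] at h2
      rcases Nat.even_or_odd sN with h | ⟨m, rfl⟩
      · exact h
      · exfalso; omega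
    obtain ⟨kk, hkk2⟩ := hseven
    -- `x' = x a^{3k}` is an involution outside `A` with `x' a x'⁻¹ = a⁹`
    obtain ⟨x', hx'⟩ : ∃ x' : K ≃ₐ[ℚ] K, x' = x * a ^ (3 * kk) := ⟨_, rfl⟩
    have hx'A : x' ∉ A := fun h => hx (by
      have : x = x' * (a ^ (3 * kk))⁻¹ := by rw [hx', mul_inv_cancel_right]
      rw [this]; exact A.mul_mem h (A.inv_mem (A.pow_mem (Subgroup.mem_zpowers a) _)))
    have hx'r : x' * a = a ^ 9 * x' := by
      rw [hx', mul_assoc, ((Commute.refl a).pow_left _).eq, ← mul_assoc, hxr, mul_assoc]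
    have hx'x' : x' * x' = 1 := by
      have hconj : x * a ^ (3 * kk) * x⁻¹ = a ^ (9 * (3 * kk)) := by rw [← conj_pow, hθ', ← pow_mul]
      rw [hx', show x * a ^ (3 * kk) * (x * a ^ (3 * kk)) = (x * a ^ (3 * kk) * x⁻¹) * (x * x) * a ^ (3 * kk) by group,
        hconj, ← hsN, hkk2, ← pow_add, ← pow_add,
        show 9 * (3 * kk) + (kk + kk) + 3 * kk = 16 * (2 * kk) by ring, pow_mul, ha16, one_pow]
    obtain ⟨Φ, φ, X, ι, ϑ, H1, H2, -⟩ :=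
      exists_simple_degenerate_lawA_modular_thirtytwo hdeg a x' ha hx'A hx'r hx'x' hcA'
    exact H2 (hgood Φ φ H1)
  · /- `x a x⁻¹ = a⁻¹ a⁸ = a⁷`: `SD₃₂` -/
    exfalso
    have ha7 : a⁻¹ * a ^ 8 = a ^ 7 := by rw [inv_mul_eq_iff_eq_mul, ← pow_succ']
    have hθ' : x * a * x⁻¹ = a ^ 7 := by rw [hθ, ha7]
    have hxr : x * a = a ^ 7 * x := by rw [← hθ', inv_mul_cancel_right]
    have hs2 : x * x = 1 ∨ x * x = a ^ 8 := by
      have h1 := hconjsq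
      rw [← conj_pow, hθ', ← pow_mul] at h1
      have h2 := pow_inj_mod.1 h1
      rw [ha] at h2
      have h8 : 8 ∣ sN := by omega
      obtain ⟨q, rfl⟩ := h8
      rcases Nat.even_or_odd q with ⟨m, rfl⟩ | ⟨m, rfl⟩
      · left; rw [← hsN, show 8 * (m + m) = 16 * m by ring, pow_mul, ha16, one_pow]
      · right; rw [← hsN, show 8 * (2 * m + 1) = 16 * m + 8 by ring, pow_add, pow_mul, ha16, one_pow, one_mul]
    rcases hs2 with hxx | hxx
    · obtain ⟨Φ, φ, X, ι, ϑ, H1, H2, -⟩ :=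
        exists_simple_degenerate_lawA_semidihedral_thirtytwo hdeg a x ha hx hxr hxx hcA'
      exact H2 (hgood Φ φ H1)
    · -- `x' = x a` is an involution outside `A` with the same action
      obtain ⟨x', hx'⟩ : ∃ x' : K ≃ₐ[ℚ] K, x' = x * a := ⟨_, rfl⟩
      have hx'A : x' ∉ A := fun h => hx (by
        have : x = x' * a⁻¹ := by rw [hx', mul_inv_cancel_right]
        rw [this]; exact A.mul_mem h (A.inv_mem (Subgroup.mem_zpowers a)))
      have hx'r : x' * a = a ^ 7 * x' := by
        rw [hx']
        calc x * a * a = a ^ 7 * x * a := by rw [hxr]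
          _ = a ^ 7 * (x * a) := mul_assoc _ _ _
      have hx'x' : x' * x' = 1 := by
        rw [hx', show x * a * (x * a) = (x * a * x⁻¹) * (x * x) * a by group, hθ', hxx, ← pow_add, ← pow_succ]
        exact ha16
      obtain ⟨Φ, φ, X, ι, ϑ, H1, H2, -⟩ :=
        exists_simple_degenerate_lawA_semidihedral_thirtytwo hdeg a x' ha hx'A hx'r hx'x' hcA'
      exact H2 (hgood Φ φ H1)

end Summit.HodgeConjecture.CorCM.GaloisModels

end
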